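/-
Copyright (c) 2026 the pub-hodgecm-mathlib formalisation cell (harness21).  Prover seat hodgecm-mathlib-K2E5-p17 (g5), Track B «K2-LIT» ∕ h413
(`stmt-HodgeConjecture-24833`), line `K2_E3_EllipticInputs`, road «GL₂-sc» (letter (S-C′-GL₂sc) of leaf (nsc-S-C′)), brick (2F-a′): the `N = 2` twin of ★ (GL-U)
`K2E3GL3ModCentreUnimodular` (K2E3-p23 (g4)).  2026-09-04.
-/
import Summits.HodgeConjecture.HodgeConjecture.Theorems.K2E3GL2ModCentre             -- ★ (2F-a) p858726 (this seat): `Ḡ = GL₂(F) ⧸ Z` frame, `K̄`, one-parameter Cartan cover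
import Summits.HodgeConjecture.HodgeConjecture.Theorems.K2E3GL3ModCentreUnimodular   -- ★ (GL-U) p857513 (K2E3-p23 (g4)): §1 generic `modularCharacter_mulEquiv_eq`
import Literature.NumberTheory.Automorphic.CartanDecompositionGLn                  -- ★ `glTranspose`
import Literature.MeasureTheory.Group.HaarRightInvariantCompactSubgroup            -- ★ `modularCharacter_eq_one_of_mem_isCompact`; brings ★ `map_mul_right_eq_modularCharacter_smul`
import HarnessLib

/-!
# Crux `H413` — K2-LIT E3, road «GL₂-sc», brick (2F-a′): `Ḡ = GL₂(F) ⧸ Z` IS UNIMODULAR — transpose-inverse sends `t̄ ↦ t̄⁻¹`, so `Δ(t̄)² = 1`; `Δ = 1` on the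
# compact `K̄`; one-parameter Cartan cover (the `N = 2` twin, statement for statement, of ★ (GL-U) `K2E3GL3ModCentreUnimodular`, K2E3-p23 (g4) p857513)

Cell `hodgecm-mathlib`, Track B, line `K2_E3_EllipticInputs`, letter (S-C′-GL₂sc) of the hosted leaf (nsc-S-C′) (leaf owner K2E3-p24 (g0); dealer K2E3-plan DEAL 2026-09-04 08:25Z;
census `K2/K2E5-p17/g5/CENSUS-GL2sc.K2E5-p17-g5.md` §2); seat K2E5-p17 (g5).  THEOREMS ONLY; count-neutral helper (`--supports stmt-HodgeConjecture-24833 --as helper`).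
Discharges the `[μ.IsMulRightInvariant]` binders of ★ FC-A ∕ FC-B ∕ F2 ∕ F3a′ when instantiated at `G := GL₂(F) ⧸ Z`.

* §1 is ★ generic (`K2E3GL3ModCentreUnimodular.modularCharacter_mulEquiv_eq`, imported): `Δ(e g) = Δ(g)` for a bi-continuous automorphism `e`.
* §2 the transpose-inverse automorphism `θ(g) = (gᵀ)⁻¹` of `GL₂(F)`: `continuous_transposeInv`, `transposeInv_zpowDiagGL` (`θ(t) = t⁻¹` on the torus), its descent
  `θ̄` to `Ḡ` (`QuotientGroup.congr`, the centre is characteristic) and `modularCharacter_mk_zpowDiagGL_eq_one` (`Δ(t̄)⁻¹ = Δ(θ̄ t̄) = Δ(t̄)`).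
* §3 **`modularCharacter_quot_eq_one`**, **`isMulRightInvariant_quot_of_isHaarMeasure`** — every Haar measure on `GL₂(F) ⧸ Z` is right invariant.

HONEST LABEL: HC_CM is proved only modulo the 7 printed citations (2 remaining named inputs: hLiu418 = stmt-HodgeConjecture-24832, h413 =
stmt-HodgeConjecture-24833) until rung 0 closes; structure theory, closes no organ by itself.

## References
* [Folland1995] G. B. Folland, *A Course in Abstract Harmonic Analysis* (1995), §2.4 (modular function; Prop. 2.27; automorphisms).
* [Cartier1979] P. Cartier, *Representations of p-adic groups: a survey*, Proc. Sympos. Pure Math. 33.1 (1979), §I.3 (reductive groups and `PGL` are unimodular).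
* [BruhatTits1972] F. Bruhat, J. Tits, *Groupes réductifs sur un corps local I*, Publ. Math. IHÉS 41 (1972), (4.4.3).
-/

set_option autoImplicit false
-- the mandated namespace repeats `HodgeConjecture.HodgeConjecture`, as in every `Theorems/*.lean` of this sub-problem
set_option linter.dupNamespace false

noncomputable section

open MeasureTheory MeasureTheory.Measure Set ValuativeRel
open scoped ENNReal NNReal Matrix MatrixGroups Pointwise WithZero Valued Topology

namespace Summit.HodgeConjecture.HodgeConjecture.Cruxes.H413.K2E3GL2ModCentreUnimodular

open Literature.NumberTheory.Automorphic Literature.MeasureTheory.Group K2E3GL2ModCentre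
open K2E3GL3ModCentreUnimodular (modularCharacter_mulEquiv_eq)


/-! ## §2 The transpose-inverse automorphism of `GL₂(F)` and its descent to `Ḡ` -/

section TransposeInv

variable {F : Type*} [Field F] [Valued F ℤᵐ⁰] [ValuativeRel F] [(Valued.v : Valuation F ℤᵐ⁰).Compatible] [IsNonarchimedeanLocalField F]

omit [Valued F ℤᵐ⁰] [ValuativeRel F] [(Valued.v : Valuation F ℤᵐ⁰).Compatible] [IsNonarchimedeanLocalField F] in
/-- `θ(g) = (gᵀ)⁻¹` is an involution of `GL₂(F)`: `θ (θ g) = g`. [folklore] -/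
theorem transposeInv_transposeInv (g : GL (Fin 2) F) :
    ((glTranspose (Fin 2)).trans (MulEquiv.inv' (GL (Fin 2) F)).symm) (((glTranspose (Fin 2)).trans (MulEquiv.inv' (GL (Fin 2) F)).symm) g) = g := by
  apply Units.ext
  simp [MulEquiv.trans_apply, glTranspose]

omit [Valued F ℤᵐ⁰] [ValuativeRel F] [(Valued.v : Valuation F ℤᵐ⁰).Compatible] [IsNonarchimedeanLocalField F] in
/-- The matrix of `θ(g)` is `(g⁻¹)ᵀ` and the matrix of `θ(g)⁻¹` is `gᵀ`. [folklore] -/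
theorem coe_transposeInv (g : GL (Fin 2) F) :
    ((((glTranspose (Fin 2)).trans (MulEquiv.inv' (GL (Fin 2) F)).symm) g : GL (Fin 2) F) : Matrix (Fin 2) (Fin 2) F) =
        (((g⁻¹ : GL (Fin 2) F)) : Matrix (Fin 2) (Fin 2) F)ᵀ ∧
      (((((glTranspose (Fin 2)).trans (MulEquiv.inv' (GL (Fin 2) F)).symm) g)⁻¹ : GL (Fin 2) F) : Matrix (Fin 2) (Fin 2) F) =
        ((g : GL (Fin 2) F) : Matrix (Fin 2) (Fin 2) F)ᵀ := by
  constructor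
  · simp [MulEquiv.trans_apply, glTranspose, Matrix.transpose_nonsing_inv]
  · simp [MulEquiv.trans_apply, glTranspose]

omit [ValuativeRel F] [(Valued.v : Valuation F ℤᵐ⁰).Compatible] [IsNonarchimedeanLocalField F] in
/-- `θ` is continuous. [folklore] -/
theorem continuous_transposeInv : Continuous ((glTranspose (Fin 2)).trans (MulEquiv.inv' (GL (Fin 2) F)).symm : GL (Fin 2) F → GL (Fin 2) F) := by
  refine Units.continuous_iff.2 ⟨?_, ?_⟩
  · have h : (Units.val ∘ ((glTranspose (Fin 2)).trans (MulEquiv.inv' (GL (Fin 2) F)).symm : GL (Fin 2) F → GL (Fin 2) F)) =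
        fun g : GL (Fin 2) F => (((g⁻¹ : GL (Fin 2) F)) : Matrix (Fin 2) (Fin 2) F)ᵀ := funext fun g => (coe_transposeInv g).1
    rw [h]
    exact Units.continuous_coe_inv.matrix_transpose
  · have h : (fun g : GL (Fin 2) F => (((((glTranspose (Fin 2)).trans (MulEquiv.inv' (GL (Fin 2) F)).symm) g)⁻¹ : GL (Fin 2) F) : Matrix (Fin 2) (Fin 2) F)) =
        fun g : GL (Fin 2) F => ((g : GL (Fin 2) F) : Matrix (Fin 2) (Fin 2) F)ᵀ := funext fun g => (coe_transposeInv g).2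
    rw [h]
    exact Units.continuous_val.matrix_transpose

omit [Valued F ℤᵐ⁰] [ValuativeRel F] [(Valued.v : Valuation F ℤᵐ⁰).Compatible] [IsNonarchimedeanLocalField F] in
/-- `θ(zpowDiagGL e) = (zpowDiagGL e)⁻¹` (diagonal matrices are symmetric). [folklore] -/
theorem transposeInv_zpowDiagGL {ϖ : F} (hϖ0 : ϖ ≠ 0) (e : Fin 2 → ℤ) :
    ((glTranspose (Fin 2)).trans (MulEquiv.inv' (GL (Fin 2) F)).symm) (zpowDiagGL (n := 2) hϖ0 e) = (zpowDiagGL (n := 2) hϖ0 e)⁻¹ := by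
  have ht : (glTranspose (Fin 2) (zpowDiagGL (n := 2) hϖ0 e)).unop = zpowDiagGL (n := 2) hϖ0 e := by
    apply Units.ext
    rw [coe_unop_glTranspose, coe_zpowDiagGL, Matrix.diagonal_transpose]
  simp [MulEquiv.trans_apply, ht]

end TransposeInv

/-! ## §3 `Δ ≡ 1` on `Ḡ` and right invariance -/

section Unimodular

variable {F : Type*} [Field F] [Valued F ℤᵐ⁰] [ValuativeRel F] [(Valued.v : Valuation F ℤᵐ⁰).Compatible] [IsNonarchimedeanLocalField F]
  [MeasurableSpace (GL (Fin 2) F ⧸ Subgroup.center (GL (Fin 2) F))] [BorelSpace (GL (Fin 2) F ⧸ Subgroup.center (GL (Fin 2) F))]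

omit [(Valued.v : Valuation F ℤᵐ⁰).Compatible] in
/-- **`Δ_Ḡ(t̄) = 1` on the torus classes**: with `θ̄` the descent of `θ(g) = (gᵀ)⁻¹` to `Ḡ` (the centre is characteristic), `θ̄(t̄) = t̄⁻¹`, so
`Δ(t̄)⁻¹ = Δ(θ̄ t̄) = Δ(t̄)` (§1) and `Δ(t̄) = 1` in `ℝ≥0`. [cite: Folland1995, §2.4] [cite: Cartier1979, §I.3] -/
theorem modularCharacter_mk_zpowDiagGL_eq_one [LocallyCompactSpace (GL (Fin 2) F)] {ϖ : F} (hϖ0 : ϖ ≠ 0) (e : Fin 2 → ℤ) :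
    modularCharacter (QuotientGroup.mk' (Subgroup.center (GL (Fin 2) F)) (zpowDiagGL (n := 2) hϖ0 e)) = 1 := by
  haveI : SecondCountableTopology (GL (Fin 2) F) := secondCountableTopology_gl2 F
  haveI : T2Space (GL (Fin 2) F ⧸ Subgroup.center (GL (Fin 2) F)) := t2Space_quot F
  -- the automorphism and its descent
  set θ : GL (Fin 2) F ≃* GL (Fin 2) F := (glTranspose (Fin 2)).trans (MulEquiv.inv' (GL (Fin 2) F)).symm with hθ
  have hθc : Continuous θ := continuous_transposeInv
  have hZ : (Subgroup.center (GL (Fin 2) F)).map θ.toMonoidHom = Subgroup.center (GL (Fin 2) F) :=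
    Subgroup.characteristic_iff_map_eq.1 inferInstance θ
  set θb : (GL (Fin 2) F ⧸ Subgroup.center (GL (Fin 2) F)) ≃* (GL (Fin 2) F ⧸ Subgroup.center (GL (Fin 2) F)) :=
    QuotientGroup.congr (Subgroup.center (GL (Fin 2) F)) (Subgroup.center (GL (Fin 2) F)) θ hZ with hθb
  have hθb_mk : ∀ g : GL (Fin 2) F, θb (QuotientGroup.mk g) = QuotientGroup.mk (θ g) := fun g => QuotientGroup.congr_mk _ _ θ hZ g
  have hθbc : Continuous θb := by
    refine (QuotientGroup.isQuotientMap_mk (Subgroup.center (GL (Fin 2) F))).continuous_iff.2 ?_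
    have : (θb : _ → _) ∘ QuotientGroup.mk = QuotientGroup.mk ∘ θ := funext fun g => hθb_mk g
    rw [this]; exact QuotientGroup.continuous_mk.comp hθc
  -- `θb` is an involution, hence `θb.symm = θb` is continuous too
  have hinv : ∀ x, θb (θb x) = x := by
    intro x
    induction x using QuotientGroup.induction_on with
    | H g => rw [hθb_mk, hθb_mk, hθ, transposeInv_transposeInv]
  have hsymm : ∀ x, θb.symm x = θb x := fun x => by
    conv_lhs => rw [← hinv x]
    exact θb.symm_apply_apply _
  have hθbsc : Continuous θb.symm := by
    have : (θb.symm : _ → _) = θb := funext hsymm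
    rw [this]; exact hθbc
  -- `θb t̄ = t̄⁻¹`
  have ht : θb (QuotientGroup.mk' (Subgroup.center (GL (Fin 2) F)) (zpowDiagGL (n := 2) hϖ0 e)) =
      (QuotientGroup.mk' (Subgroup.center (GL (Fin 2) F)) (zpowDiagGL (n := 2) hϖ0 e))⁻¹ := by
    rw [QuotientGroup.mk'_apply, hθb_mk, hθ, transposeInv_zpowDiagGL, QuotientGroup.mk_inv]
  have hΔ := modularCharacter_mulEquiv_eq θb hθbc hθbsc (QuotientGroup.mk' (Subgroup.center (GL (Fin 2) F)) (zpowDiagGL (n := 2) hϖ0 e))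
  rw [ht, map_inv] at hΔ
  -- `x⁻¹ = x`, `x > 0` ⇒ `x = 1` (in `ℝ`)
  set x : ℝ≥0 := modularCharacter (QuotientGroup.mk' (Subgroup.center (GL (Fin 2) F)) (zpowDiagGL (n := 2) hϖ0 e)) with hx
  have hxpos : (0 : ℝ) < (x : ℝ) := by exact_mod_cast modularCharacterFun_pos (G := GL (Fin 2) F ⧸ Subgroup.center (GL (Fin 2) F)) _
  have hxinv : ((x : ℝ))⁻¹ = (x : ℝ) := by rw [← NNReal.coe_inv, hΔ]
  have hxx : (x : ℝ) * (x : ℝ) = 1 := by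
    calc (x : ℝ) * (x : ℝ) = ((x : ℝ))⁻¹ * (x : ℝ) := by rw [hxinv]
      _ = 1 := inv_mul_cancel₀ hxpos.ne'
  have hreal : (x : ℝ) = 1 := by
    rcases mul_self_eq_one_iff.1 hxx with h | h
    · exact h
    · linarith
  exact_mod_cast hreal

/-- **THE MODULAR CHARACTER OF `GL₂(F) ⧸ Z` IS TRIVIAL**: `Δ = 1` on the compact `K̄` (★ `modularCharacter_eq_one_of_mem_isCompact`) and on the torus classes
(`modularCharacter_mk_zpowDiagGL_eq_one`), and `Ḡ = ⋃ K̄ t̄_a K̄` (★ (2F-a) Cartan cover). [cite: Cartier1979, §I.3] [cite: Folland1995, §2.4] -/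
theorem modularCharacter_quot_eq_one [LocallyCompactSpace (GL (Fin 2) F)] {ϖ : F} (hϖ : Valued.v ϖ = WithZero.exp (-1 : ℤ))
    (x : GL (Fin 2) F ⧸ Subgroup.center (GL (Fin 2) F)) : modularCharacter x = 1 := by
  haveI : SecondCountableTopology (GL (Fin 2) F) := secondCountableTopology_gl2 F
  haveI : T2Space (GL (Fin 2) F ⧸ Subgroup.center (GL (Fin 2) F)) := t2Space_quot F
  have hϖ0 : ϖ ≠ 0 := fun h => by rw [h, map_zero] at hϖ; exact WithZero.zero_ne_coe hϖ
  have hKc := isCompact_kbar F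
  obtain ⟨a, ha⟩ := exists_mem_doubleCoset_mk_tOne hϖ hϖ0 x
  obtain ⟨y, hy, k₂, hk₂, rfl⟩ := Set.mem_mul.1 ha
  obtain ⟨k₁, hk₁, t, ht, rfl⟩ := Set.mem_mul.1 hy
  rw [Set.mem_singleton_iff] at ht
  subst ht
  rw [map_mul, map_mul, modularCharacter_eq_one_of_mem_isCompact _ hKc hk₁, modularCharacter_eq_one_of_mem_isCompact _ hKc hk₂,
    modularCharacter_mk_zpowDiagGL_eq_one hϖ0, one_mul, one_mul]

/-- **`GL₂(F) ⧸ Z` IS UNIMODULAR**: every Haar measure on it is right invariant. [cite: Cartier1979, §I.3] [cite: Folland1995, §2.4] -/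
theorem isMulRightInvariant_quot_of_isHaarMeasure {ϖ : F} (hϖ : Valued.v ϖ = WithZero.exp (-1 : ℤ))
    (μ : Measure (GL (Fin 2) F ⧸ Subgroup.center (GL (Fin 2) F))) [μ.IsHaarMeasure] : μ.IsMulRightInvariant := by
  haveI : SecondCountableTopology (GL (Fin 2) F) := secondCountableTopology_gl2 F
  haveI : LocallyCompactSpace (GL (Fin 2) F) := locallyCompactSpace_gl2 F
  haveI : T2Space (GL (Fin 2) F ⧸ Subgroup.center (GL (Fin 2) F)) := t2Space_quot F
  refine ⟨fun g => ?_⟩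
  rw [map_mul_right_eq_modularCharacter_smul μ g, modularCharacter_quot_eq_one hϖ g, one_smul]

end Unimodular

end Summit.HodgeConjecture.HodgeConjecture.Cruxes.H413.K2E3GL2ModCentreUnimodular

end
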